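import Summits.BirchSwinnertonDyer.BirchSwinnertonDyer.Theorems.QuadraticBranchSignedControlPlusEtaNonsurjThetaFunctionalEquationExactBranch
import HarnessLib

/-!
# Route `QuadraticBranchSignedControl` (rung K8, cell `bsd-potss`), residual crux `PlusEtaMainConjectureNonsurj`
# (stmt-BirchSwinnertonDyer-19606): THE FUNCTIONAL EQUATION ON THE QUADRATIC BRANCH, XII — THE PARITY LAWS FACT-FREE:
# `(−1)^{λ(L)} = (−1)^{ord_T L} = σ·(−N | p)` and `sign −1 ⇒ L(0) = 0` for EVERY nonzero `L_p^±(V, η, X)`, ANY period ratio, and at a row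
# WITHOUT Mazur's Manin-constant fact (seat `bsd-potss-k8eta-c2` g28; kernel, class-wide)

WHY. Parts V–VII (p761517, p761839, p762376) proved the parity laws `(−1)^{λ(L)} = (−1)^{ord_T L} = σ·(−N | p)` for the branch functions
`L = L_p^±(V, η, X)` under the hypothesis `‖ϖ‖_p ≤ 1` on the period ratio, which at a row of the crux was discharged by the NAMED FACT
`mazur_not_dvd_maninConstant_of_odd` (Mazur 1978: the Manin constant is a `p`-adic unit) together with the period relation `hrel`. Part X
(p763347) proved the EXACT functional equation `ι L = w·(1+T)^e·L` for EVERY period ratio `ϖ ∈ ℚ` (scale by `p^k`, cancel in the domain `Λ`).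
THIS FILE re-derives the parity laws from the exact equation, so that they hold for ANY `ϖ` and, at a row, with NO named fact and NO period
relation: the lineage's parity statements (`(−1)^{λ±} = w(W)`, `λ⁺ ≡ λ⁻ ≡ ord_T (mod 2)`, `w(W) = −1 ⇒ L_p⁺(V, η, 0) = 0`) become
hypothesis-free beyond the row data (`V` good at `p ≥ 5`, `a_p(V) = 0`, `f` its newform, `L` a branch function).

MATHEMATICS. From `ι L = w U L` (`U(0) = 1`): `(−1)^{ord L} = w` is the barrier lemma `eq_neg_one_pow_of_subst_eq` (leading coefficients,
`ι T = −T + ⋯`); `(−1)^{λ(L)} = w` is Part III's `neg_one_pow_lam_eq_of_invol_sub_eq_mul` with the remainder `D·G`, `D = T^{λ+1}`, `G = 0`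
(`p ∤ T^{λ+1}`, its coefficients below `λ+1` vanish); `L(0)·(1 − w) = 0` from the constant terms (`(ι L)(0) = L(0)`), and `2 ≠ 0` in `ℤ_p`.

WHAT. §26 generic: `neg_one_pow_lam_eq_of_invol_eq`, `neg_one_pow_order_eq_of_invol_eq`, `constantCoeff_eq_zero_of_invol_eq_neg`; branch (any `ϖ`):
**`neg_one_pow_lam_eq_sign_of_isQuadraticBranch{Plus,Minus}LFunction'`**, `neg_one_pow_order_eq_sign_of_isQuadraticBranch{Plus,Minus}LFunction'`,
`neg_one_pow_lam_plus_eq_neg_one_pow_lam_minus'`, `constantCoeff_eq_zero_of_sign_eq_neg_one_of_isQuadraticBranchPlusLFunction'`; §27 rows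
(NO `hM`, NO `hrel`): **`neg_one_pow_lam_{plus,minus}_row'`**, `neg_one_pow_order_plus_row'`, conductor level **`neg_one_pow_lam_plus_eq_rootNumber_mul_legendreSym'`**,
`constantCoeff_plus_eq_zero_of_rootNumber_mul_legendreSym_eq_neg_one'`.

HONEST FRAMING (cell `bsd-potss`; FULL-BSD rank ≤ 1 programme, HUMAN RULING D-0036/D-0074): TOOL THEOREMS ONLY — no definition, no named
fact USED OR MINTED, no `sorry`, axioms standard; nothing about (A), (C1⁺_η), C-cc-1 or `BSD(W,p)` of any pair is claimed; no stub of 19606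
is proved; crux and route OPEN; nothing booked. `--supports stmt-BirchSwinnertonDyer-19606`.

References: [MazurTateTeitelbaum1986Invent] §I.17; [GreenbergLNM1716] §1 and §5 (p. 181: "the 'signs' … are the same"); [Sprung2017] Cor. 4.14;
[Kobayashi2003] Thm. 3.2, (3.4)–(3.6); [AtkinLehner1970] Thm. 3. Tree: Parts III, V–VII, X; `Literature.Barriers.BirchSwinnertonDyer.eq_neg_one_pow_of_subst_eq`.
-/

set_option autoImplicit false
set_option linter.dupNamespace false
noncomputable section

open scoped Classical MatrixGroups ModularForm

open CongruenceSubgroup Polynomial WeierstrassCurve Literature.NumberTheory.EllipticCurves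
  Literature.NumberTheory.EllipticCurves.ModularForms
open Literature.NumberTheory.EllipticCurves.IwasawaAlgebra
open Summit.BirchSwinnertonDyer.Rank1Residual.Additive
open Summit.BirchSwinnertonDyer.Rank1Residual.X1.MuLambda (lam)

namespace Summit.BirchSwinnertonDyer.BirchSwinnertonDyer.Theorems.EtaThetaFunctionalEquation

variable {p : ℕ} [hp : Fact p.Prime]

/-! ## §26 Parity from an EXACT functional equation `ι F = w·(1+T)^e·F` -/

/-- `p ∤ T^n` in `Λ` (its top coefficient is `1`). [folklore] -/
theorem not_C_dvd_X_pow (n : ℕ) : ¬ PowerSeries.C (p : ℤ_[p]) ∣ (PowerSeries.X : PowerSeries ℤ_[p]) ^ n := by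
  rintro ⟨E, hE⟩
  have h1 := congr_arg (PowerSeries.coeff n) hE
  rw [PowerSeries.coeff_X_pow_self, PowerSeries.coeff_C_mul] at h1
  exact (PadicInt.irreducible_p (p := p)).not_isUnit (isUnit_of_dvd_one ⟨_, h1⟩)

/-- **`(−1)^{λ(F)} = w` from an exact functional equation** `ι F = w·(1+T)^e·F`, `F ≠ 0`, `w = ±1`, `p` odd (Part III's lemma with remainder
`T^{λ+1}·0`). [cite: GreenbergLNM1716, §5] [cite: Washington1997, §7.1 and §13.2] -/
theorem neg_one_pow_lam_eq_of_invol_eq (hp2 : p ≠ 2) {F : PowerSeries ℤ_[p]} (hF : F ≠ 0) {w : ℤ} (hw : w = 1 ∨ w = -1) {e : ℤ_[p]}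
    (hFE : invol p F = PowerSeries.C (w : ℤ_[p]) * PowerSeries.binomialSeries ℤ_[p] e * F) : (-1 : ℤ) ^ lam F = w := by
  refine neg_one_pow_lam_eq_of_invol_sub_eq_mul hp2 hF hw (PowerSeries.binomialSeries_constantCoeff (A := ℤ_[p]) e)
    (D := PowerSeries.X ^ (lam F + 1)) (G := 0) (fun i hi ↦ ?_) (not_C_dvd_X_pow _) ?_
  · rw [PowerSeries.coeff_X_pow, if_neg (by omega)]; exact dvd_zero _
  · rw [hFE, sub_self, mul_zero]

/-- **`(−1)^{ord_T F} = w` from an exact functional equation** (`F ≠ 0`; the barrier lemma `eq_neg_one_pow_of_subst_eq`).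
[cite: GreenbergLNM1716, §5] -/
theorem neg_one_pow_order_eq_of_invol_eq {F : PowerSeries ℤ_[p]} (hF : F ≠ 0) {w e : ℤ_[p]}
    (hFE : invol p F = PowerSeries.C w * PowerSeries.binomialSeries ℤ_[p] e * F) : (-1 : ℤ_[p]) ^ F.order.toNat = w := by
  have hne : F.order ≠ ⊤ := fun h ↦ hF (PowerSeries.order_eq_top.mp h)
  have hord : F.order = (F.order.toNat : ℕ) := (ENat.coe_toNat hne).symm
  refine (Literature.Barriers.BirchSwinnertonDyer.eq_neg_one_pow_of_subst_eq (constantCoeff_invSubOne p) (coeff_one_invSubOne p)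
    (PowerSeries.binomialSeries_constantCoeff (A := ℤ_[p]) e) ?_ hord).symm
  rw [← invol_apply]; exact hFE

/-- **Sign `−1` forces `F(0) = 0`** under an exact functional equation (`(ι F)(0) = F(0)`, so `2·F(0) = 0` in `ℤ_p`). [folklore] -/
theorem constantCoeff_eq_zero_of_invol_eq_neg {F : PowerSeries ℤ_[p]} {e : ℤ_[p]}
    (hFE : invol p F = PowerSeries.C (-1 : ℤ_[p]) * PowerSeries.binomialSeries ℤ_[p] e * F) : PowerSeries.constantCoeff F = 0 := by
  have h := congr_arg PowerSeries.constantCoeff hFE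
  rw [IwasawaAlgebra.constantCoeff_invol, map_mul, map_mul, PowerSeries.constantCoeff_C, PowerSeries.binomialSeries_constantCoeff,
    mul_one] at h
  have h2 : (2 : ℤ_[p]) * PowerSeries.constantCoeff F = 0 := by linear_combination h
  exact (mul_eq_zero.mp h2).resolve_left two_ne_zero

section Branch

variable {N : ℕ} [NeZero N] {f : CuspForm (Gamma0 N) 2}

/-- **PARITY OF `λ⁺`, ANY PERIOD RATIO**: for `p` odd, `f` a rational newform of level `N` prime to `p` with `a_p(f) = 0` and Fricke sign `σ`, and
ANY nonzero `L` with `IsQuadraticBranchPlusLFunction f p ϖ L` (`ϖ ∈ ℚ` arbitrary): `(−1)^{λ(L)} = σ·(−N | p)`. Part V's theorem without `‖ϖ‖_p ≤ 1`.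
[cite: MazurTateTeitelbaum1986Invent, §I.17] [cite: GreenbergLNM1716, §5] [cite: Kobayashi2003, Thm. 3.2, (3.4)] -/
theorem neg_one_pow_lam_eq_sign_of_isQuadraticBranchPlusLFunction' (hp2 : p ≠ 2) (hf0 : IsNewform0 f)
    (hQ : coeffField f = ⊥) (hpN : ¬ p ∣ N) (hap : cuspCoeff f p = ((0 : ℤ) : ℂ)) {σ : ℤ} (hσ : σ ^ 2 = 1)
    (hW : atkinLehnerInvolution N 2 N f = (-(σ : ℂ)) • f)
    {ϖ : ℚ} {L : IwasawaAlgebra p} (hL : IsQuadraticBranchPlusLFunction f p ϖ L) (hL0 : L ≠ 0) :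
    (-1 : ℤ) ^ lam L = σ * legendreSym p (-(N : ℤ)) := by
  obtain ⟨e, he⟩ := exists_invol_eq_of_isQuadraticBranchPlusLFunction hp2 hf0 hQ hpN hap hσ hW hL
  exact neg_one_pow_lam_eq_of_invol_eq hp2 hL0 (sign_eq_one_or hpN hσ) he

/-- **PARITY OF `λ⁻`, ANY PERIOD RATIO** (minus twin). [cite: MazurTateTeitelbaum1986Invent, §I.17] [cite: Kobayashi2003, Thm. 3.2, (3.5)] -/
theorem neg_one_pow_lam_eq_sign_of_isQuadraticBranchMinusLFunction' (hp2 : p ≠ 2) (hf0 : IsNewform0 f)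
    (hQ : coeffField f = ⊥) (hpN : ¬ p ∣ N) (hap : cuspCoeff f p = ((0 : ℤ) : ℂ)) {σ : ℤ} (hσ : σ ^ 2 = 1)
    (hW : atkinLehnerInvolution N 2 N f = (-(σ : ℂ)) • f)
    {ϖ : ℚ} {L : IwasawaAlgebra p} (hL : IsQuadraticBranchMinusLFunction f p ϖ L) (hL0 : L ≠ 0) :
    (-1 : ℤ) ^ lam L = σ * legendreSym p (-(N : ℤ)) := by
  obtain ⟨e, he⟩ := exists_invol_eq_of_isQuadraticBranchMinusLFunction hp2 hf0 hQ hpN hap hσ hW hL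
  exact neg_one_pow_lam_eq_of_invol_eq hp2 hL0 (sign_eq_one_or hpN hσ) he

/-- **`λ⁺ ≡ λ⁻ (mod 2)`, SIGN-FREE, ANY PERIOD RATIOS.** [cite: MazurTateTeitelbaum1986Invent, §I.17] [cite: Kobayashi2003, Thm. 3.2] -/
theorem neg_one_pow_lam_plus_eq_neg_one_pow_lam_minus' (hp2 : p ≠ 2) (hf0 : IsNewform0 f)
    (hQ : coeffField f = ⊥) (hpN : ¬ p ∣ N) (hap : cuspCoeff f p = ((0 : ℤ) : ℂ))
    {ϖ ϖ' : ℚ} {Lp Lm : IwasawaAlgebra p} (hLp : IsQuadraticBranchPlusLFunction f p ϖ Lp) (hLp0 : Lp ≠ 0)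
    (hLm : IsQuadraticBranchMinusLFunction f p ϖ' Lm) (hLm0 : Lm ≠ 0) :
    (-1 : ℤ) ^ lam Lp = (-1) ^ lam Lm := by
  obtain ⟨σ, hσ, hW⟩ := exists_frickeSign_of_isNewform0 hf0
  rw [neg_one_pow_lam_eq_sign_of_isQuadraticBranchPlusLFunction' hp2 hf0 hQ hpN hap hσ hW hLp hLp0,
    neg_one_pow_lam_eq_sign_of_isQuadraticBranchMinusLFunction' hp2 hf0 hQ hpN hap hσ hW hLm hLm0]

/-- **PARITY OF `ord_{T=0}`, ANY PERIOD RATIO (plus)**: `(−1)^{ord_T L} = σ·(−N | p)`. [cite: GreenbergLNM1716, §5]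
[cite: MazurTateTeitelbaum1986Invent, §I.17] -/
theorem neg_one_pow_order_eq_sign_of_isQuadraticBranchPlusLFunction' (hp2 : p ≠ 2) (hf0 : IsNewform0 f)
    (hQ : coeffField f = ⊥) (hpN : ¬ p ∣ N) (hap : cuspCoeff f p = ((0 : ℤ) : ℂ)) {σ : ℤ} (hσ : σ ^ 2 = 1)
    (hW : atkinLehnerInvolution N 2 N f = (-(σ : ℂ)) • f)
    {ϖ : ℚ} {L : IwasawaAlgebra p} (hL : IsQuadraticBranchPlusLFunction f p ϖ L) (hL0 : L ≠ 0) :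
    (-1 : ℤ) ^ L.order.toNat = σ * legendreSym p (-(N : ℤ)) := by
  obtain ⟨e, he⟩ := exists_invol_eq_of_isQuadraticBranchPlusLFunction hp2 hf0 hQ hpN hap hσ hW hL
  have h := neg_one_pow_order_eq_of_invol_eq hL0 he
  exact_mod_cast h

/-- **PARITY OF `ord_{T=0}`, ANY PERIOD RATIO (minus)**. [cite: GreenbergLNM1716, §5] [cite: MazurTateTeitelbaum1986Invent, §I.17] -/
theorem neg_one_pow_order_eq_sign_of_isQuadraticBranchMinusLFunction' (hp2 : p ≠ 2) (hf0 : IsNewform0 f)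
    (hQ : coeffField f = ⊥) (hpN : ¬ p ∣ N) (hap : cuspCoeff f p = ((0 : ℤ) : ℂ)) {σ : ℤ} (hσ : σ ^ 2 = 1)
    (hW : atkinLehnerInvolution N 2 N f = (-(σ : ℂ)) • f)
    {ϖ : ℚ} {L : IwasawaAlgebra p} (hL : IsQuadraticBranchMinusLFunction f p ϖ L) (hL0 : L ≠ 0) :
    (-1 : ℤ) ^ L.order.toNat = σ * legendreSym p (-(N : ℤ)) := by
  obtain ⟨e, he⟩ := exists_invol_eq_of_isQuadraticBranchMinusLFunction hp2 hf0 hQ hpN hap hσ hW hL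
  have h := neg_one_pow_order_eq_of_invol_eq hL0 he
  exact_mod_cast h

/-- **SIGN `−1` FORCES `L(0) = 0`, ANY PERIOD RATIO**: if `σ·(−N | p) = −1` then every plus branch function has constant term `0`
(`L_p⁺(V, η, 0) = 0` when `w(V ⊗ η) = −1`). Part VI's theorem without `‖ϖ‖_p ≤ 1`. [cite: Kobayashi2003, (3.6) (p. 7)]
[cite: MazurTateTeitelbaum1986Invent, §I.17] -/
theorem constantCoeff_eq_zero_of_sign_eq_neg_one_of_isQuadraticBranchPlusLFunction' (hp2 : p ≠ 2) (hf0 : IsNewform0 f)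
    (hQ : coeffField f = ⊥) (hpN : ¬ p ∣ N) (hap : cuspCoeff f p = ((0 : ℤ) : ℂ)) {σ : ℤ} (hσ : σ ^ 2 = 1)
    (hW : atkinLehnerInvolution N 2 N f = (-(σ : ℂ)) • f) (hsign : σ * legendreSym p (-(N : ℤ)) = -1)
    {ϖ : ℚ} {L : IwasawaAlgebra p} (hL : IsQuadraticBranchPlusLFunction f p ϖ L) :
    PowerSeries.constantCoeff L = 0 := by
  obtain ⟨e, he⟩ := exists_invol_eq_of_isQuadraticBranchPlusLFunction hp2 hf0 hQ hpN hap hσ hW hL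
  rw [hsign, Int.cast_neg, Int.cast_one] at he
  exact constantCoeff_eq_zero_of_invol_eq_neg he

end Branch

/-! ## §27 Row currency WITHOUT the Manin-constant fact and WITHOUT the period relation -/

section Row

variable {N : ℕ} [NeZero N] {f : CuspForm (Gamma0 N) 2}

/-- **PARITY OF `λ⁺` AT A ROW, FACT-FREE.** `V` globally minimal, good at `p ≥ 5` with `a_p(V) = 0` (every row of crux 19606), `f` its newform
(any level `N`) with Fricke sign `σ`; for ANY `ϖ` and every NONZERO plus branch function `Lη`: `(−1)^{λ(Lη)} = σ·(−N | p)`. Part V's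
`neg_one_pow_lam_plus_row` with the named fact `hM` (Mazur) and the period relation `hrel` REMOVED. [cite: MazurTateTeitelbaum1986Invent, §I.17]
[cite: Kobayashi2003, Thm. 3.2, (3.4)] -/
theorem neg_one_pow_lam_plus_row' (hp5 : 5 ≤ p) (V : WeierstrassCurve ℚ) [V.IsElliptic] [V.IsGloballyMinimal]
    (hgood : V.HasGoodReductionAtPrime p) (hap : V.frobeniusTrace p = 0) (hf : IsNewformOf V f) {σ : ℤ} (hσ : σ ^ 2 = 1)
    (hW : atkinLehnerInvolution N 2 N f = (-(σ : ℂ)) • f)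
    (ϖ : ℚ) {Lη : IwasawaAlgebra p} (hL : IsQuadraticBranchPlusLFunction f p ϖ Lη) (hL0 : Lη ≠ 0) :
    (-1 : ℤ) ^ lam Lη = σ * legendreSym p (-(N : ℤ)) := by
  have hp2 : p ≠ 2 := by omega
  have hap' : cuspCoeff f p = ((0 : ℤ) : ℂ) := by
    rw [cuspCoeff_eq_frobeniusTrace_of_isNewformOf_holds hf hgood, hap]
  exact neg_one_pow_lam_eq_sign_of_isQuadraticBranchPlusLFunction' hp2 hf.1 hf.coeffField_eq_bot
    (not_dvd_level_of_isNewformOf hf hgood) hap' hσ hW hL hL0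

/-- **PARITY OF `λ⁻` AT A ROW, FACT-FREE** (minus twin). [cite: MazurTateTeitelbaum1986Invent, §I.17] [cite: Kobayashi2003, Thm. 3.2, (3.5)] -/
theorem neg_one_pow_lam_minus_row' (hp5 : 5 ≤ p) (V : WeierstrassCurve ℚ) [V.IsElliptic] [V.IsGloballyMinimal]
    (hgood : V.HasGoodReductionAtPrime p) (hap : V.frobeniusTrace p = 0) (hf : IsNewformOf V f) {σ : ℤ} (hσ : σ ^ 2 = 1)
    (hW : atkinLehnerInvolution N 2 N f = (-(σ : ℂ)) • f)
    (ϖ : ℚ) {Lη : IwasawaAlgebra p} (hL : IsQuadraticBranchMinusLFunction f p ϖ Lη) (hL0 : Lη ≠ 0) :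
    (-1 : ℤ) ^ lam Lη = σ * legendreSym p (-(N : ℤ)) := by
  have hp2 : p ≠ 2 := by omega
  have hap' : cuspCoeff f p = ((0 : ℤ) : ℂ) := by
    rw [cuspCoeff_eq_frobeniusTrace_of_isNewformOf_holds hf hgood, hap]
  exact neg_one_pow_lam_eq_sign_of_isQuadraticBranchMinusLFunction' hp2 hf.1 hf.coeffField_eq_bot
    (not_dvd_level_of_isNewformOf hf hgood) hap' hσ hW hL hL0

/-- **`λ⁺ ≡ λ⁻ (mod 2)` AT A ROW, FACT-FREE and sign-free.** [cite: MazurTateTeitelbaum1986Invent, §I.17] [cite: Kobayashi2003, Thm. 3.2] -/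
theorem neg_one_pow_lam_plus_eq_neg_one_pow_lam_minus_row' (hp5 : 5 ≤ p) (V : WeierstrassCurve ℚ) [V.IsElliptic]
    [V.IsGloballyMinimal] (hgood : V.HasGoodReductionAtPrime p) (hap : V.frobeniusTrace p = 0) (hf : IsNewformOf V f) (ϖ ϖ' : ℚ)
    {Lp Lm : IwasawaAlgebra p} (hLp : IsQuadraticBranchPlusLFunction f p ϖ Lp) (hLp0 : Lp ≠ 0)
    (hLm : IsQuadraticBranchMinusLFunction f p ϖ' Lm) (hLm0 : Lm ≠ 0) :
    (-1 : ℤ) ^ lam Lp = (-1) ^ lam Lm := by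
  have hp2 : p ≠ 2 := by omega
  have hap' : cuspCoeff f p = ((0 : ℤ) : ℂ) := by
    rw [cuspCoeff_eq_frobeniusTrace_of_isNewformOf_holds hf hgood, hap]
  exact neg_one_pow_lam_plus_eq_neg_one_pow_lam_minus' hp2 hf.1 hf.coeffField_eq_bot (not_dvd_level_of_isNewformOf hf hgood)
    hap' hLp hLp0 hLm hLm0

/-- **PARITY OF `ord_{T=0} L_p⁺(V,η,X)` AT A ROW, FACT-FREE.** [cite: GreenbergLNM1716, §5] [cite: MazurTateTeitelbaum1986Invent, §I.17] -/
theorem neg_one_pow_order_plus_row' (hp5 : 5 ≤ p) (V : WeierstrassCurve ℚ) [V.IsElliptic] [V.IsGloballyMinimal]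
    (hgood : V.HasGoodReductionAtPrime p) (hap : V.frobeniusTrace p = 0) (hf : IsNewformOf V f) {σ : ℤ} (hσ : σ ^ 2 = 1)
    (hW : atkinLehnerInvolution N 2 N f = (-(σ : ℂ)) • f)
    (ϖ : ℚ) {Lη : IwasawaAlgebra p} (hL : IsQuadraticBranchPlusLFunction f p ϖ Lη) (hL0 : Lη ≠ 0) :
    (-1 : ℤ) ^ Lη.order.toNat = σ * legendreSym p (-(N : ℤ)) := by
  have hp2 : p ≠ 2 := by omega
  have hap' : cuspCoeff f p = ((0 : ℤ) : ℂ) := by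
    rw [cuspCoeff_eq_frobeniusTrace_of_isNewformOf_holds hf hgood, hap]
  exact neg_one_pow_order_eq_sign_of_isQuadraticBranchPlusLFunction' hp2 hf.1 hf.coeffField_eq_bot
    (not_dvd_level_of_isNewformOf hf hgood) hap' hσ hW hL hL0

end Row

section Root

variable {V : WeierstrassCurve ℚ} [V.IsElliptic] [NeZero (V.conductorNorm ℤ)]
  {f : CuspForm (Gamma0 (V.conductorNorm ℤ)) 2} [V.IsGloballyMinimal]

/-- **`(−1)^{λ(L_p⁺(V,η,X))} = w_V·(−N_V | p)` — FACT-FREE, ANY PERIOD RATIO** (conductor-level newform; the right-hand side is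
`w_V·η(−N_V) = w(V ⊗ η)`, the root number of the additive partner `W = V^{(p*)}`). Part VII's theorem with `hM`, `hrel` removed.
[cite: MazurTateTeitelbaum1986Invent, §I.17] [cite: AtkinLehner1970, Thm. 3] [cite: Kobayashi2003, Thm. 3.2, (3.4)] -/
theorem neg_one_pow_lam_plus_eq_rootNumber_mul_legendreSym' (hp5 : 5 ≤ p) (hgood : V.HasGoodReductionAtPrime p)
    (hap : V.frobeniusTrace p = 0) (hf : IsNewformOf V f) (ϖ : ℚ) {Lη : IwasawaAlgebra p}
    (hL : IsQuadraticBranchPlusLFunction f p ϖ Lη) (hL0 : Lη ≠ 0) :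
    (-1 : ℤ) ^ lam Lη = V.rootNumber * legendreSym p (-(V.conductorNorm ℤ : ℤ)) :=
  neg_one_pow_lam_plus_row' hp5 V hgood hap hf rootNumber_sq_eq_one (atkinLehnerInvolution_eq_neg_rootNumber_smul hf) ϖ hL hL0

/-- **`(−1)^{λ(L_p⁻(V,η,X))} = w_V·(−N_V | p)` — FACT-FREE, ANY PERIOD RATIO** (minus twin). [cite: MazurTateTeitelbaum1986Invent, §I.17]
[cite: AtkinLehner1970, Thm. 3] [cite: Kobayashi2003, Thm. 3.2, (3.5)] -/
theorem neg_one_pow_lam_minus_eq_rootNumber_mul_legendreSym' (hp5 : 5 ≤ p) (hgood : V.HasGoodReductionAtPrime p)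
    (hap : V.frobeniusTrace p = 0) (hf : IsNewformOf V f) (ϖ : ℚ) {Lη : IwasawaAlgebra p}
    (hL : IsQuadraticBranchMinusLFunction f p ϖ Lη) (hL0 : Lη ≠ 0) :
    (-1 : ℤ) ^ lam Lη = V.rootNumber * legendreSym p (-(V.conductorNorm ℤ : ℤ)) :=
  neg_one_pow_lam_minus_row' hp5 V hgood hap hf rootNumber_sq_eq_one (atkinLehnerInvolution_eq_neg_rootNumber_smul hf) ϖ hL hL0

/-- **`(−1)^{ord_{T=0} L_p⁺(V,η,X)} = w_V·(−N_V | p)` — FACT-FREE, ANY PERIOD RATIO.** [cite: GreenbergLNM1716, §5]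
[cite: MazurTateTeitelbaum1986Invent, §I.17] [cite: AtkinLehner1970, Thm. 3] -/
theorem neg_one_pow_order_plus_eq_rootNumber_mul_legendreSym' (hp5 : 5 ≤ p) (hgood : V.HasGoodReductionAtPrime p)
    (hap : V.frobeniusTrace p = 0) (hf : IsNewformOf V f) (ϖ : ℚ) {Lη : IwasawaAlgebra p}
    (hL : IsQuadraticBranchPlusLFunction f p ϖ Lη) (hL0 : Lη ≠ 0) :
    (-1 : ℤ) ^ Lη.order.toNat = V.rootNumber * legendreSym p (-(V.conductorNorm ℤ : ℤ)) :=
  neg_one_pow_order_plus_row' hp5 V hgood hap hf rootNumber_sq_eq_one (atkinLehnerInvolution_eq_neg_rootNumber_smul hf) ϖ hL hL0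

/-- **`w_V·(−N_V | p) = −1 ⇒ L_p⁺(V, η, 0) = 0` — FACT-FREE, ANY PERIOD RATIO** (every plus branch function of the conductor-level newform).
[cite: Kobayashi2003, (3.6) (p. 7)] [cite: MazurTateTeitelbaum1986Invent, §I.17] [cite: AtkinLehner1970, Thm. 3] -/
theorem constantCoeff_plus_eq_zero_of_rootNumber_mul_legendreSym_eq_neg_one' (hp5 : 5 ≤ p)
    (hgood : V.HasGoodReductionAtPrime p) (hap : V.frobeniusTrace p = 0) (hf : IsNewformOf V f)
    (hsign : V.rootNumber * legendreSym p (-(V.conductorNorm ℤ : ℤ)) = -1) (ϖ : ℚ) {Lη : IwasawaAlgebra p}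
    (hL : IsQuadraticBranchPlusLFunction f p ϖ Lη) : PowerSeries.constantCoeff Lη = 0 := by
  have hp2 : p ≠ 2 := by omega
  have hap' : cuspCoeff f p = ((0 : ℤ) : ℂ) := by
    rw [cuspCoeff_eq_frobeniusTrace_of_isNewformOf_holds hf hgood, hap]
  exact constantCoeff_eq_zero_of_sign_eq_neg_one_of_isQuadraticBranchPlusLFunction' hp2 hf.1 hf.coeffField_eq_bot
    (not_dvd_level_of_isNewformOf hf hgood) hap' rootNumber_sq_eq_one (atkinLehnerInvolution_eq_neg_rootNumber_smul hf) hsign hL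

end Root

end Summit.BirchSwinnertonDyer.BirchSwinnertonDyer.Theorems.EtaThetaFunctionalEquation

end
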